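import Mathlib
import HarnessLib
import Summits.Ventures.LatticeQCDFlow.Exactness.NCMCGeneralSpaceEventTauIntPositive

/-!
# The HOLDING floor: a kernel whose rows keep an atom of mass `r(x)` at `x` (every Metropolized sampler: `r` = rejection probability) has `σ²_f ≥ ∫ r f̄² dπ` for EVERY bounded observable — hence `τ_int ≥ r₀/2` whenever `r ≥ r₀`, reversible or not

HONEST FRAMING: exact (Metropolis-corrected) sampling algorithms for lattice gauge theory;
figures of merit are autocorrelation/cost numbers at stated couplings and volumes; no
continuum-physics claim.

Venture `LatticeQCDFlow` (cell pub-lqcd), topic `Exactness`; FANOUT row 13 (`eng-snf`, GEN-21).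
NEW WORK of the cell, not a published result; no definition is introduced; nothing is cited as a
fact.  Fifth sufficient condition in GEN-21's non-degeneracy chapter (events: any kernel; reversible:
any observable; NCMC lane: explicit; counterexample: atomless non-reversible three-valued): if
`ENNReal.ofReal (r x) • δ_x ≤ κ(x, ·)` for every `x` (the Metropolis REJECTION keeps the chain at `x`
with probability at least `r(x)`), then with `h` the bounded Poisson solution of `h − κh = f̄` the
conditional variance at `x` is at least the atom's contribution `r(x) (h(x) − κh(x))² = r(x) f̄(x)²`, so
`σ²_f = ∫ (κ(h²) − (κh)²) dπ ≥ ∫ r f̄² dπ`.  Row 8's `Scoring/IndepMHRejectionFloor` is the sharper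
REVERSIBLE statement for the flow sampler (`ρ(1) ≥ r_g`, AR(1) floor); here: ANY kernel with a Doeblin
power (for the Poisson solution), no reversibility, every bounded observable and every event.

## Content (`κ` Markov, `π` invariant, `ε • ν ≤ (nHit κ m)(z, ·)`, `ε ≠ 0`, `0 < m`; `r ≥ 0`
## measurable with `ENNReal.ofReal (r x) • dirac x ≤ κ x`)

* `holding_le_one` — `r x ≤ 1`.
* **`greenKubo_variance_ge_integral_holding_of_nHit`** — `∫ r (f − πf)² dπ ≤ C_f̄(0) + 2 Σ' C_f̄(t+1)`.
* **`tauInt_ge_half_holding_of_nHit`** — if `r₀ ≤ r` everywhere and `Var_π f > 0`: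
  `r₀/2 ≤ Scoring.tauInt (t ↦ C_f̄(t)/C_f̄(0))`.
* **`tauInt_setACF_ge_integral_holding_of_nHit`** — events: `(∫ r (1_A − p)² dπ)/(2 p(1 − p)) ≤ τ_int(setACF κ π A)`;
  `tauInt_setACF_ge_half_holding_of_nHit` — `r₀/2 ≤ τ_int(setACF κ π A)`.

NOT CLAIMED: kernels without atoms (the NCMC iteration kernel AFTER a heat-bath level move has
none — see `NCMCGeneralSpaceOccupancyTauIntLowerBound` for that lane); sharpness; unbounded observables.
-/

namespace Summit.Ventures.LatticeQCDFlow.Exactness.GeneralNCMC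

open MeasureTheory ProbabilityTheory Set Filter Finset
open scoped ENNReal NNReal Topology

variable {S : Type*} [MeasurableSpace S]

section Holding

variable {κ : Kernel S S} [IsMarkovKernel κ] {π : Measure S} [IsProbabilityMeasure π]
  {ν : Measure S} [IsProbabilityMeasure ν] {ε : ℝ≥0∞} {m : ℕ}

omit [IsProbabilityMeasure π] in
/-- An atom below a probability row has mass at most one: `r x ≤ 1`. -/
theorem holding_le_one {r : S → ℝ} (hatom : ∀ x, ENNReal.ofReal (r x) • Measure.dirac x ≤ κ x)
    (x : S) : r x ≤ 1 := by
  have h := Measure.le_iff'.1 (hatom x) univ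
  rw [Measure.smul_apply, smul_eq_mul, measure_univ, mul_one, measure_univ] at h
  exact ENNReal.ofReal_le_one.1 h

/-- **THE HOLDING FLOOR.**  `κ` Markov with invariant probability law `π` and a Doeblin power
`ε • ν ≤ (nHit κ m)(z, ·)` (`ε ≠ 0`, `0 < m`); `r ≥ 0` measurable with
`ENNReal.ofReal (r x) • dirac x ≤ κ(x, ·)` for every `x`; `f` bounded measurable.  Then
`∫ r (f − πf)² dπ ≤ C_f̄(0) + 2 Σ'_t C_f̄(t+1) = σ²_f`. -/
theorem greenKubo_variance_ge_integral_holding_of_nHit (hπ : Kernel.Invariant κ π) (hε : ε ≠ 0)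
    (hmin : ∀ z, ε • ν ≤ nHit κ m z) (hm : 0 < m)
    {r : S → ℝ} (hrm : Measurable r) (hr0 : ∀ x, 0 ≤ r x)
    (hatom : ∀ x, ENNReal.ofReal (r x) • Measure.dirac x ≤ κ x)
    {f : S → ℝ} (hf : Measurable f) {C : ℝ} (hC : ∀ x, |f x| ≤ C) :
    ∫ x, r x * (f x - ∫ z, f z ∂π) ^ 2 ∂π
      ≤ Scoring.autocov κ π (fun y => f y - ∫ z, f z ∂π) 0
        + 2 * ∑' t, Scoring.autocov κ π (fun y => f y - ∫ z, f z ∂π) (t + 1) := by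
  haveI : Nonempty S := nonempty_of_isProbabilityMeasure π
  have hε1 : ε ≤ 1 := by
    haveI := isMarkovKernel_nHit κ m
    exact eps_le_one_of_minorised hmin
  have hε0 : 0 < ε := pos_iff_ne_zero.2 hε
  have hminS : ∀ x {B : Set S}, MeasurableSet B → ε * ν B ≤ nHit κ m x B :=
    fun z B hB => minorised_setwise hmin z hB
  have hr1 : ∀ x, r x ≤ 1 := holding_le_one hatom
  obtain ⟨hfb, hCfb, hfb0⟩ := Scoring.centred_observable_bounds π hf hC
  obtain ⟨h, hhm, hhb, hpois⟩ := poisson_exists_of_nHit hminS hε0 hε1 hm hπ hfb hCfb hfb0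
  have hGK := integral_sq_sub_sq_kop_eq_greenKubo_of_nHit hminS hε0 hε1 hm hπ hfb hCfb hfb0
    hhm hhb hpois
  obtain ⟨hKm, hKb⟩ := Scoring.iterate_kop_bounded_measurable κ hhm hhb 1
  simp only [Function.iterate_one] at hKm hKb
  have h0 : Scoring.autocov κ π (fun y => f y - ∫ z, f z ∂π) 0
      = ∫ x, (f x - ∫ z, f z ∂π) ^ 2 ∂π := by
    unfold Scoring.autocov
    simp only [Function.iterate_zero, id_eq, sq]
  rw [h0, ← hGK, ← integral_condVar_eq_sq_sub_sq_kop hπ hhm hhb]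
  -- pointwise: `r x f̄(x)² ≤ κ(h²)(x) − (κh x)²`
  have hpt : ∀ x, r x * (f x - ∫ z, f z ∂π) ^ 2
      ≤ Scoring.kop κ (fun y => h y ^ 2) x - (Scoring.kop κ h x) ^ 2 := by
    intro x
    rw [kop_sq_sub_sq_eq_integral κ hhm hhb x, ← hpois x]
    have hgm : Measurable fun y => (h y - Scoring.kop κ h x) ^ 2 := (hhm.sub_const _).pow_const 2
    have hgb : ∀ y, |(h y - Scoring.kop κ h x) ^ 2| ≤ (2 * (2 * C) * m / ε.toReal + 2 * (2 * C) * m / ε.toReal) ^ 2 :=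
      fun y => by
        rw [abs_pow]
        exact pow_le_pow_left₀ (abs_nonneg _) ((abs_sub _ _).trans (add_le_add (hhb y) (hKb x))) 2
    have hmono : ∫ y, (h y - Scoring.kop κ h x) ^ 2 ∂(ENNReal.ofReal (r x) • Measure.dirac x)
        ≤ ∫ y, (h y - Scoring.kop κ h x) ^ 2 ∂(κ x) :=
      integral_mono_measure (hatom x) (ae_of_all _ fun y => sq_nonneg _)
        (Scoring.integrable_of_bounded _ hgm hgb)
    rw [integral_smul_measure, ENNReal.toReal_ofReal (hr0 x), smul_eq_mul,
      integral_dirac' _ _ hgm.stronglyMeasurable] at hmono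
    exact hmono
  -- integrate
  have hLm : Measurable fun x => r x * (f x - ∫ z, f z ∂π) ^ 2 := hrm.mul (hfb.pow_const 2)
  have hLb : ∀ x, |r x * (f x - ∫ z, f z ∂π) ^ 2| ≤ 1 * (2 * C) ^ 2 := fun x => by
    rw [abs_mul, abs_of_nonneg (hr0 x), abs_pow]
    exact mul_le_mul (hr1 x) (pow_le_pow_left₀ (abs_nonneg _) (hCfb x) 2) (pow_nonneg (abs_nonneg _) _)
      zero_le_one
  have hqm : Measurable fun x => Scoring.kop κ (fun y => h y ^ 2) x - (Scoring.kop κ h x) ^ 2 :=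
    (Scoring.measurable_kop κ (hhm.pow_const 2)).sub (hKm.pow_const 2)
  have hqb : ∀ x, |Scoring.kop κ (fun y => h y ^ 2) x - (Scoring.kop κ h x) ^ 2|
      ≤ (2 * (2 * C) * m / ε.toReal) ^ 2 + (2 * (2 * C) * m / ε.toReal) ^ 2 :=
    fun x => (abs_sub _ _).trans (add_le_add
      (Scoring.abs_kop_le κ (fun y => by
        rw [abs_pow]; exact pow_le_pow_left₀ (abs_nonneg _) (hhb y) 2) x)
      (by rw [abs_pow]; exact pow_le_pow_left₀ (abs_nonneg _) (hKb x) 2))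
  exact integral_mono (Scoring.integrable_of_bounded π hLm hLb) (Scoring.integrable_of_bounded π hqm hqb)
    hpt

/-- **`τ_int ≥ r₀/2` FOR EVERY BOUNDED OBSERVABLE** when the holding probability is at least `r₀`
everywhere (`Var_π f > 0`). -/
theorem tauInt_ge_half_holding_of_nHit (hπ : Kernel.Invariant κ π) (hε : ε ≠ 0)
    (hmin : ∀ z, ε • ν ≤ nHit κ m z) (hm : 0 < m)
    {r : S → ℝ} (hrm : Measurable r) (hr0 : ∀ x, 0 ≤ r x)
    (hatom : ∀ x, ENNReal.ofReal (r x) • Measure.dirac x ≤ κ x) {r₀ : ℝ} (hr : ∀ x, r₀ ≤ r x)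
    {f : S → ℝ} (hf : Measurable f) {C : ℝ} (hC : ∀ x, |f x| ≤ C)
    (hvar : 0 < ∫ x, (f x - ∫ z, f z ∂π) ^ 2 ∂π) :
    r₀ / 2 ≤ Scoring.tauInt (fun t => Scoring.autocov κ π (fun y => f y - ∫ z, f z ∂π) t
        / Scoring.autocov κ π (fun y => f y - ∫ z, f z ∂π) 0) := by
  have hmain := greenKubo_variance_ge_integral_holding_of_nHit hπ hε hmin hm hrm hr0 hatom hf hC
  have h0 : Scoring.autocov κ π (fun y => f y - ∫ z, f z ∂π) 0
      = ∫ x, (f x - ∫ z, f z ∂π) ^ 2 ∂π := by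
    unfold Scoring.autocov
    simp only [Function.iterate_zero, id_eq, sq]
  set a0 := Scoring.autocov κ π (fun y => f y - ∫ z, f z ∂π) 0 with ha0
  have ha0pos : 0 < a0 := by rw [h0]; exact hvar
  -- `∫ r f̄² ≥ r₀ ∫ f̄² = r₀ a0`
  obtain ⟨hfb, hCfb, -⟩ := Scoring.centred_observable_bounds π hf hC
  have hlow : r₀ * a0 ≤ ∫ x, r x * (f x - ∫ z, f z ∂π) ^ 2 ∂π := by
    rw [h0, ← integral_const_mul]
    have hr1 : ∀ x, r x ≤ 1 := holding_le_one hatom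
    refine integral_mono ((Scoring.integrable_of_bounded π (hfb.pow_const 2) (C := (2 * C) ^ 2) fun x => by
        rw [abs_pow]; exact pow_le_pow_left₀ (abs_nonneg _) (hCfb x) 2).const_mul _)
      (Scoring.integrable_of_bounded π (hrm.mul (hfb.pow_const 2)) (C := 1 * (2 * C) ^ 2) fun x => by
        rw [abs_mul, abs_of_nonneg (hr0 x), abs_pow]
        exact mul_le_mul (hr1 x) (pow_le_pow_left₀ (abs_nonneg _) (hCfb x) 2)
          (pow_nonneg (abs_nonneg _) _) zero_le_one)
      fun x => mul_le_mul_of_nonneg_right (hr x) (sq_nonneg _)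
  -- `σ² = 2 a0 τ`
  have hτ : a0 + 2 * ∑' t, Scoring.autocov κ π (fun y => f y - ∫ z, f z ∂π) (t + 1)
      = 2 * a0 * Scoring.tauInt (fun t => Scoring.autocov κ π (fun y => f y - ∫ z, f z ∂π) t / a0) := by
    have ha0ne : a0 ≠ 0 := ha0pos.ne'
    unfold Scoring.tauInt
    rw [tsum_div_const]
    field_simp
  have h2 : r₀ * a0 ≤ 2 * a0 * Scoring.tauInt
      (fun t => Scoring.autocov κ π (fun y => f y - ∫ z, f z ∂π) t / a0) := by
    rw [← hτ]; exact hlow.trans hmain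
  rw [div_le_iff₀ (by norm_num : (0 : ℝ) < 2)]
  nlinarith [h2, ha0pos]

/-- **The holding floor for events**: `(∫ r (1_A − p)² dπ) / (2 p (1 − p)) ≤ τ_int(setACF κ π A)` for
every measurable `A` with `0 < p = π(A) < 1`. -/
theorem tauInt_setACF_ge_integral_holding_of_nHit (hπ : Kernel.Invariant κ π) (hε : ε ≠ 0)
    (hmin : ∀ z, ε • ν ≤ nHit κ m z) (hm : 0 < m)
    {r : S → ℝ} (hrm : Measurable r) (hr0 : ∀ x, 0 ≤ r x)
    (hatom : ∀ x, ENNReal.ofReal (r x) • Measure.dirac x ≤ κ x)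
    {A : Set S} (hA : MeasurableSet A) (h0 : 0 < π.real A) (h1 : π.real A < 1) :
    (∫ x, r x * (A.indicator (1 : S → ℝ) x - π.real A) ^ 2 ∂π) / (2 * (π.real A * (1 - π.real A)))
      ≤ Scoring.tauInt (setACF κ π A) := by
  have hf : Measurable (A.indicator (1 : S → ℝ)) := measurable_one.indicator hA
  have hC : ∀ y, |A.indicator (1 : S → ℝ) y| ≤ 1 := fun y => by
    by_cases hy : y ∈ A <;> simp [hy]
  have hmean : ∫ z, A.indicator (1 : S → ℝ) z ∂π = π.real A := integral_indicator_one hA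
  have hv0 : 0 < π.real A * (1 - π.real A) := mul_pos h0 (sub_pos.2 h1)
  have hmain := greenKubo_variance_ge_integral_holding_of_nHit hπ hε hmin hm hrm hr0 hatom hf hC
  rw [← cltVariance_eq_autocov κ π, greenKubo_indicator_eq_tauInt hπ hA h0 h1, hmean] at hmain
  rw [div_le_iff₀ (by positivity)]
  linarith

/-- **`τ_int(A) ≥ r₀/2` for every event** when the holding probability is at least `r₀` everywhere. -/
theorem tauInt_setACF_ge_half_holding_of_nHit (hπ : Kernel.Invariant κ π) (hε : ε ≠ 0)
    (hmin : ∀ z, ε • ν ≤ nHit κ m z) (hm : 0 < m)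
    {r : S → ℝ} (hrm : Measurable r) (hr0 : ∀ x, 0 ≤ r x)
    (hatom : ∀ x, ENNReal.ofReal (r x) • Measure.dirac x ≤ κ x) {r₀ : ℝ} (hr : ∀ x, r₀ ≤ r x)
    {A : Set S} (hA : MeasurableSet A) (h0 : 0 < π.real A) (h1 : π.real A < 1) :
    r₀ / 2 ≤ Scoring.tauInt (setACF κ π A) := by
  have hπ' := hπ
  have hf : Measurable (A.indicator (1 : S → ℝ)) := measurable_one.indicator hA
  have hC : ∀ y, |A.indicator (1 : S → ℝ) y| ≤ 1 := fun y => by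
    by_cases hy : y ∈ A <;> simp [hy]
  have hmean : ∫ z, A.indicator (1 : S → ℝ) z ∂π = π.real A := integral_indicator_one hA
  have hvar : 0 < ∫ x, (A.indicator (1 : S → ℝ) x - ∫ z, A.indicator (1 : S → ℝ) z ∂π) ^ 2 ∂π := by
    rw [hmean, ← Scoring.autocov_zero κ π, autocov_centredIndicator_eq_setAutocov hπ hA 0,
      setAutocov_zero hA]
    exact mul_pos h0 (sub_pos.2 h1)
  have h := tauInt_ge_half_holding_of_nHit hπ' hε hmin hm hrm hr0 hatom hr hf hC hvar
  have hfun : (fun t => Scoring.autocov κ π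
        (fun y => A.indicator (1 : S → ℝ) y - ∫ z, A.indicator (1 : S → ℝ) z ∂π) t
        / Scoring.autocov κ π
          (fun y => A.indicator (1 : S → ℝ) y - ∫ z, A.indicator (1 : S → ℝ) z ∂π) 0)
      = setACF κ π A := by
    funext t
    rw [hmean, autocov_centredIndicator_eq_setAutocov hπ hA t,
      autocov_centredIndicator_eq_setAutocov hπ hA 0]
    rfl
  rw [hfun] at h
  exact h

end Holding

end Summit.Ventures.LatticeQCDFlow.Exactness.GeneralNCMC
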